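import Summits.CriticalPhenomena.PercolationContinuityZ3.Theorems.PercTiltedBlockersWideBoxFromTilt
import Summits.CriticalPhenomena.PercolationContinuityZ3.Theorems.PercNonProliferationSubpolynomialBlockingStubTiling
import HarnessLib

/-!
# Crux `CubeBlockingSeed` (stmt-CriticalPhenomena-1141), line `registered` — stub `stub_tallTilt`: consistency certificate `stub_tallTiltOfWideSeeds`

Helper file for the lead's skeleton of the line `registered` (`Cruxes/CubeBlockingSeed/Lines/birth.lean`)
of the crux `Summit.CriticalPhenomena.PercolationContinuityZ3.Theses.PercTiltedBlockers.CubeBlockingSeed`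
(shared verbatim with `Theses.PercAnnulusCrossing.CubeBlockingSeed`); lands with
`--supports stmt-CriticalPhenomena-1141` under the stub name `stub_tallTiltOfWideSeeds` (registered by
`workitem stub-add`).

Write `R(h; L, M) = [0,h] × [0,L] × [0,M] ⊆ ℤ³` (`Finset.Icc 0 ![h, L, M]`, `x₀` = height),
`β(h; L, M) := P_{p_c(ℤ³)}(R(h;L,M) blocked)` (no open path inside the box from `{x₀ = 0}` to `{x₀ = h}`)
and, for a level `a`, `Tilt(R; δ, a)` := "no open path inside `R` from `Src = {x₀ = 0} ∪ {x₁ = L, x₀ < a}`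
to `Tgt = {x₀ = h} ∪ {x₁ = δ, x₀ ≥ a}`" (the route's tilt event, `Theses.PercTiltedBlockers.TiltComparison`).
The registered stub `stub_tallTilt` of the line is the TALL TILT COMPARISON
`∀ k ≥ 1, ∃ g ↑, g > 0 on (0,∞), ∀ m ≥ 1, ∀ L M ∈ [2m, 5m], ∃ a, g(β(4km; L, M)) ≤ P(Tilt(R(4km; L, M); m, a))`
— a Benjamini–Kalai "RSW for plaquettes" input at `p_c(ℤ³)` on the tall family (open in print, like its
flat twin `TiltComparison`, stmt-CriticalPhenomena-6393). It is NOT proved here. Cheap checks (all negative,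
so the stub stands as registered): (i) no level `a` trivialises it — `Tilt ⊆ Blocked` always, and for
`0 < a ≤ 4km` the configuration whose only open edges form the path `(a-1, L, 0) → (a, L, 0) → (a, L-1, 0) →
⋯ → (a, m, 0)` is blocked but not tilted, while for `a = 0` (resp. `a > 4km`) the point `(0, m, 0)` (resp.
`(4km, L, 0)`) lies in `Src ∩ Tgt`, so `Tilt = ∅`; hence `g = id` is not available; (ii) no degenerate
instance refutes it — for `1 ≤ a ≤ 4km`, `Src ∩ Tgt = ∅` (`L ≥ 2m > m`), so every single shape has
`P(Tilt) ≥ (1 - p_c)^{#pairs} > 0` (`tilt_floor`), and a refutation needs a whole sequence of shapes with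
`β ≥ s₀` and `sup_a P(Tilt_a) → 0`; (iii) the proved shape calculus cannot give it — height monotonicity,
width anti-monotonicity and the lattice symmetries map face-to-face seal events to face-to-face seal events
and only bound `P(Tilt) ≤ β`, never a mixed-face event from below; the one tool producing mixed events,
gluing of seals (Union Lemma), needs TRANSVERSE seals of commensurate boxes, i.e. an RSW-type input.

What IS proved (the consistency certificate asked for by the lead): **flat wide seeds give the tall tilt
comparison with a CONSTANT `g`**,
`stub_tallTiltOfWideSeeds : (∃ c > 0, ∀ m ≥ 1, c ≤ β(4m; 24m, 24m)) → stub_tallTilt`, the hypothesis being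
verbatim the conclusion of the route item `Theses.PercTiltedBlockers.WideBoxFromTilt` (PROVED from
`TiltComparison ∧ CubeBlockingSeed`, `Theorems.wideBoxFromTilt_proof`); hence
`tallTilt_of_tiltComparison_of_cubeBlockingSeed : TiltComparison → CubeBlockingSeed → stub_tallTilt` — the
stub is not stronger than the route's two cruxes together (honest-piece check; circular as a PROOF of the
crux, of course).

Proof. STAIRCASE (`TallTiltOfWideSeeds.staircase`, deterministic, lattice configurations `ω ⊆ E(ℤ³)`):
if a full-cross-section horizontal slab `D` of `R` lying strictly below the level `a` is sealed across the
height, a full-cross-section slab `U ⊆ {a ≤ x₀}` is sealed across the height, and a vertical slab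
`V = {heights of D ∪ U} × [L₁, L₂] × [0, M]` with `m < L₁ ≤ L₂ < L` is sealed across `x₁`, then `Tilt(R; m, a)`
holds: an open `Src → Tgt` walk ending on the top traverses `U` upwards (`exists_traverse`); one from the
bottom to the high left plane traverses `D`; one from the low right patch to the high left plane is confined
between `D` and `U` (`walk_band_trichotomy` in the height, twice) and then traverses `V` in the direction `x₁`
(`walk_band_trichotomy` in `x₁`). SEALS (`tilt_ge`): at scale `μ` the three slabs are the wide box
`[0,4μ] × [0,24μ]²` itself (`D`, level `a = 4μ + 1`), its translate by `(4μ+1) e₀` (`U`,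
`StubTiling.real_seal_shift`) and its `(0 1)`-transpose translated by `(m+1) e₁` (`V`,
`StubTiling.real_seal_perm_shift`), provided `8μ + 1 ≤ 4km`, `L, M ≤ 24μ`, `m + 4μ + 1 < L`; Harris–FKG for
the three decreasing events (`harris_fkg_lower`, Grimmett 1999 Thm. 2.4) and the a.e. lattice reduction
(`DCT16.real_mono_of_forall_subset_edgeSet`) give `P(Tilt) ≥ c³`. SCALES (`stub_tallTiltOfWideSeeds`): for
`m ≥ 30`, `μ = ⌊(m-2)/4⌋ ≥ 7` fits (`24μ ≥ 6m - 30 ≥ 5m ≥ L, M`, `m + 4μ + 1 ≤ 2m - 1 < L`,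
`8μ + 1 ≤ 2m - 3 < 4km`); the shapes with `m ≤ 29` (finitely many for each `k`: `L, M ≤ 145`, height
`4km ≤ 116k`) have `P(Tilt) ≥ (1 - p_c)^{#pairs of [0,116k]×[0,145]²} > 0` (`tilt_floor`, `p_c(ℤ³) < 1`); so
`g :≡ min(c³, floor_k)` (constant, hence monotone) serves all `m`. No new definitions.
-/

noncomputable section

namespace Summit.CriticalPhenomena.PercolationContinuityZ3.Theorems.CubeBlockingSeed

open MeasureTheory Literature.Probability.Percolation Literature.Probability.LatticeModels
open Literature.Barriers.CriticalPhenomena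
open Summit.CriticalPhenomena.PercolationContinuityZ3.Theorems.SubpolynomialBlocking

namespace TallTiltOfWideSeeds

/-! ### The staircase: three seals force the tilt event (lattice configurations) -/

/-- Membership in a coordinate box `Set.Icc lo hi` of `ℤ³` from the six coordinate inequalities.
[folklore] -/
theorem mem_sIcc_of {lo hi x : Site 3} (h0 : lo 0 ≤ x 0) (h1 : lo 1 ≤ x 1) (h2 : lo 2 ≤ x 2)
    (h0' : x 0 ≤ hi 0) (h1' : x 1 ≤ hi 1) (h2' : x 2 ≤ hi 2) : x ∈ Set.Icc lo hi := by
  rw [← Finset.coe_Icc, Finset.mem_coe, TiltSquaring.mem_Icc3]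
  exact ⟨⟨h0, h1, h2⟩, ⟨h0', h1', h2'⟩⟩

/-- **STAIRCASE LEMMA** (deterministic, lattice configurations `ω ⊆ E(ℤ³)`). In the box
`R = [0,H] × [0,LL] × [0,MM]` with tilt level `A`, let `D = Icc dlo dhi` and `U = Icc ulo uhi` be boxes
containing the full cross-section `[0,LL] × [0,MM]` in the directions `1, 2`, with heights
`0 ≤ dlo₀ ≤ dhi₀ < A ≤ ulo₀ ≤ uhi₀ ≤ H`, and let `V = Icc vlo vhi` contain `[dlo₀, uhi₀] × · × [0, MM]` with
`δ < vlo₁ ≤ vhi₁ < LL`. If `D` and `U` are sealed across the height `0` and `V` is sealed across `1`, then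
no open path inside `R` joins `Src = {x₀ = 0} ∪ {x₁ = LL, x₀ < A}` to `Tgt = {x₀ = H} ∪ {x₁ = δ, x₀ ≥ A}`:
a walk to the top traverses `U` (`exists_traverse`), a walk from the bottom to the high plane traverses
`D`, and a walk from the low right patch to the high left plane stays between `D` and `U`
(`walk_band_trichotomy` in the height) and traverses `V` along `x₁`. [folklore] -/
theorem staircase {H LL MM δ A : ℤ} {dlo dhi ulo uhi vlo vhi : Site 3}
    (hD0 : 0 ≤ dlo 0) (hD0' : dlo 0 ≤ dhi 0) (hDA : dhi 0 < A) (hD1 : dlo 1 ≤ 0) (hD1' : LL ≤ dhi 1)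
    (hD2 : dlo 2 ≤ 0) (hD2' : MM ≤ dhi 2)
    (hUA : A ≤ ulo 0) (hU0 : ulo 0 ≤ uhi 0) (hUH : uhi 0 ≤ H) (hU1 : ulo 1 ≤ 0) (hU1' : LL ≤ uhi 1)
    (hU2 : ulo 2 ≤ 0) (hU2' : MM ≤ uhi 2)
    (hV0 : vlo 0 ≤ dlo 0) (hV0' : uhi 0 ≤ vhi 0) (hV1 : δ < vlo 1) (hV1' : vlo 1 ≤ vhi 1)
    (hV1'' : vhi 1 < LL) (hV2 : vlo 2 ≤ 0) (hV2' : MM ≤ vhi 2)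
    {ω : BondConfig (Site 3)} (hω : ω ⊆ (zdGraph 3).edgeSet)
    (hD : ω ∈ (openCrossing (Set.Icc dlo dhi) {x | x ∈ Set.Icc dlo dhi ∧ x 0 = dlo 0}
      {y | y ∈ Set.Icc dlo dhi ∧ y 0 = dhi 0})ᶜ)
    (hU : ω ∈ (openCrossing (Set.Icc ulo uhi) {x | x ∈ Set.Icc ulo uhi ∧ x 0 = ulo 0}
      {y | y ∈ Set.Icc ulo uhi ∧ y 0 = uhi 0})ᶜ)
    (hV : ω ∈ (openCrossing (Set.Icc vlo vhi) {x | x ∈ Set.Icc vlo vhi ∧ x 1 = vlo 1}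
      {y | y ∈ Set.Icc vlo vhi ∧ y 1 = vhi 1})ᶜ) :
    ¬ ∃ x ∈ Finset.Icc (0 : Site 3) ![H, LL, MM], ∃ y ∈ Finset.Icc (0 : Site 3) ![H, LL, MM],
        (x 0 = 0 ∨ (x 1 = LL ∧ x 0 < A)) ∧ (y 0 = H ∨ (y 1 = δ ∧ A ≤ y 0)) ∧
          ω ∈ openConnIn ↑(Finset.Icc (0 : Site 3) ![H, LL, MM]) x y := by
  rintro ⟨x, hx, y, hy, hxS, hyT, hxy⟩
  obtain ⟨P, hPS, hPω⟩ := exists_walk_of_mem_openConnIn hω hxy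
  have hPR : ∀ z ∈ P.support, (0 ≤ z 0 ∧ 0 ≤ z 1 ∧ 0 ≤ z 2) ∧ (z 0 ≤ H ∧ z 1 ≤ LL ∧ z 2 ≤ MM) :=
    fun z hz => TiltSquaring.mem_box0.1 (Finset.mem_coe.1 (hPS z hz))
  have hxR := TiltSquaring.mem_box0.1 hx
  have hyR := TiltSquaring.mem_box0.1 hy
  have hxA : x 0 < A := by
    rcases hxS with h | ⟨-, h⟩
    · rw [h]; omega
    · exact h
  -- a traverse of a band inside `P`, read as an open crossing of a box containing it
  have cross : ∀ (j : Fin 3) (lo hi : Site 3) {c e : Site 3} (W : (zdGraph 3).Walk c e),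
      c j = lo j → e j = hi j → (∀ z ∈ W.support, z ∈ Set.Icc lo hi) →
        (∀ q ∈ W.edges, q ∈ P.edges) →
        ω ∈ openCrossing (Set.Icc lo hi) {x | x ∈ Set.Icc lo hi ∧ x j = lo j}
          {y | y ∈ Set.Icc lo hi ∧ y j = hi j} :=
    fun j lo hi c e W hc he hin hWe =>
      ⟨c, ⟨hin c W.start_mem_support, hc⟩, e, ⟨hin e W.end_mem_support, he⟩,
        mem_openConnIn_of_walk W hin fun q hq => hPω q (hWe q hq)⟩
  rcases hyT with hyH | ⟨hy1, hyA⟩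
  · -- `y` on the top face: the walk climbs from below `A ≤ ulo 0` to `H ≥ uhi 0`, traversing `U`
    obtain ⟨c, e, W, hc, he, hW, hWe⟩ := exists_traverse (fun z : Site 3 => z 0)
      (apply_le_apply_add_one_of_adj 0) P hU0 ⟨x, P.start_mem_support, show x 0 ≤ ulo 0 by omega⟩
      (show uhi 0 ≤ y 0 by omega)
    refine hU (cross 0 ulo uhi W hc he (fun z hz => ?_) hWe)
    obtain ⟨hzP, hz1, hz2⟩ := hW z hz
    obtain ⟨⟨h0, h1, h2⟩, ⟨h0', h1', h2'⟩⟩ := hPR z hzP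
    exact mem_sIcc_of hz1 (by omega) (by omega) hz2 (by omega) (by omega)
  · rcases hxS with hx0 | ⟨hx1, -⟩
    · -- `x` on the bottom face, `y` at height `≥ A > dhi 0`: the walk traverses `D`
      obtain ⟨c, e, W, hc, he, hW, hWe⟩ := exists_traverse (fun z : Site 3 => z 0)
        (apply_le_apply_add_one_of_adj 0) P hD0' ⟨x, P.start_mem_support, show x 0 ≤ dlo 0 by omega⟩
        (show dhi 0 ≤ y 0 by omega)
      refine hD (cross 0 dlo dhi W hc he (fun z hz => ?_) hWe)
      obtain ⟨hzP, hz1, hz2⟩ := hW z hz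
      obtain ⟨⟨h0, h1, h2⟩, ⟨h0', h1', h2'⟩⟩ := hPR z hzP
      exact mem_sIcc_of hz1 (by omega) (by omega) hz2 (by omega) (by omega)
    · -- `x` on the low right patch, `y` on the high left plane: confined between `D` and `U`,
      -- the walk traverses `V` in the direction `x₁`
      have hup : ∀ z ∈ P.support, z 0 ≤ uhi 0 := by
        rcases walk_band_trichotomy (fun z : Site 3 => z 0) (apply_le_apply_add_one_of_adj 0) P hU0
          with h | h | ⟨c, e, W, hc, he, hW, hWe⟩
        · exact h
        · have hx' : ulo 0 ≤ x 0 := h x P.start_mem_support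
          omega
        · refine absurd (cross 0 ulo uhi W hc he (fun z hz => ?_) hWe) hU
          obtain ⟨hzP, hz1, hz2⟩ := hW z hz
          obtain ⟨⟨h0, h1, h2⟩, ⟨h0', h1', h2'⟩⟩ := hPR z hzP
          exact mem_sIcc_of hz1 (by omega) (by omega) hz2 (by omega) (by omega)
      have hdown : ∀ z ∈ P.support, dlo 0 ≤ z 0 := by
        rcases walk_band_trichotomy (fun z : Site 3 => z 0) (apply_le_apply_add_one_of_adj 0) P hD0'
          with h | h | ⟨c, e, W, hc, he, hW, hWe⟩
        · have hy' : y 0 ≤ dhi 0 := h y P.end_mem_support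
          omega
        · exact h
        · refine absurd (cross 0 dlo dhi W hc he (fun z hz => ?_) hWe) hD
          obtain ⟨hzP, hz1, hz2⟩ := hW z hz
          obtain ⟨⟨h0, h1, h2⟩, ⟨h0', h1', h2'⟩⟩ := hPR z hzP
          exact mem_sIcc_of hz1 (by omega) (by omega) hz2 (by omega) (by omega)
      rcases walk_band_trichotomy (fun z : Site 3 => z 1) (apply_le_apply_add_one_of_adj 1) P hV1'
        with h | h | ⟨c, e, W, hc, he, hW, hWe⟩
      · have hx' : x 1 ≤ vhi 1 := h x P.start_mem_support
        omega
      · have hy' : vlo 1 ≤ y 1 := h y P.end_mem_support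
        omega
      · refine hV (cross 1 vlo vhi W hc he (fun z hz => ?_) hWe)
        obtain ⟨hzP, hz1, hz2⟩ := hW z hz
        obtain ⟨⟨h0, h1, h2⟩, ⟨h0', h1', h2'⟩⟩ := hPR z hzP
        have hu := hup z hzP
        have hd := hdown z hzP
        exact mem_sIcc_of (by omega) hz1 (by omega) (by omega) hz2 (by omega)

/-! ### Probability: three seals of one flat wide box, Harris–FKG -/

/-- The `Finset.Icc` spelling of "the box `Icc lo hi` is sealed across the height" is the
`Set.Icc`/`openCrossing` spelling of `StubTiling` (same set). [folklore] -/
theorem sealEvent_eq (lo hi : Site 3) :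
    {ω : BondConfig (Site 3) | ¬ ∃ x ∈ Finset.Icc lo hi, ∃ y ∈ Finset.Icc lo hi,
        x 0 = lo 0 ∧ y 0 = hi 0 ∧ ω ∈ openConnIn ↑(Finset.Icc lo hi) x y} =
      (openCrossing (Set.Icc lo hi) {x | x ∈ Set.Icc lo hi ∧ x 0 = lo 0}
        {y | y ∈ Set.Icc lo hi ∧ y 0 = hi 0})ᶜ := by
  -- adapted from `StubBlockerRSWGlue.sealEvent_eq`
  ext ω
  simp only [Set.mem_compl_iff, mem_openCrossing_iff, Set.mem_setOf_eq, Finset.coe_Icc,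
    Finset.mem_Icc, Set.mem_Icc]
  constructor
  · rintro h ⟨x, ⟨hx, hx0⟩, y, ⟨hy, hy0⟩, hω⟩
    exact h ⟨x, hx, y, hy, hx0, hy0, hω⟩
  · rintro h ⟨x, hx, y, hy, hx0, hy0, hω⟩
    exact h ⟨x, ⟨hx, hx0⟩, y, ⟨hy, hy0⟩, hω⟩

/-- **Three seals of one wide box give the tilt event.** For every `p`: if the flat wide box
`[0,4μ] × [0,24μ]²` is sealed across its thin direction with probability `≥ c ≥ 0`, then for every box
`R = [0,H] × [0,LL] × [0,MM]` with `LL, MM ≤ 24μ`, every level `A` with `4μ < A`, `A + 4μ ≤ H`,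
`A ≤ 20μ`, and every `δ` with `δ + 4μ + 1 < LL`, the tilt event `Tilt(R; δ, A)` has probability
`≥ c³`: the staircase `D = [0,4μ] × [0,24μ]²`, `U = D + A e₀` (`real_seal_shift`),
`V = [0,24μ] × [δ+1, δ+1+4μ] × [0,24μ]` (the `(0 1)`-transpose of `D` shifted, `real_seal_perm_shift`),
Harris–FKG for the three decreasing seal events (Grimmett 1999, Thm. 2.4) and `staircase` almost surely
(`DCT16.real_mono_of_forall_subset_edgeSet`). [folklore] -/
theorem tilt_ge (p : unitInterval) {c : ℝ} (hc : 0 ≤ c) {μ : ℕ}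
    (hW : c ≤ (bondPercolation (zdGraph 3) p).real
      {ω | ¬ ∃ x ∈ Finset.Icc (0 : Site 3) ![4 * (μ : ℤ), 24 * μ, 24 * μ],
        ∃ y ∈ Finset.Icc (0 : Site 3) ![4 * (μ : ℤ), 24 * μ, 24 * μ],
          x 0 = 0 ∧ y 0 = 4 * μ ∧
            ω ∈ openConnIn ↑(Finset.Icc (0 : Site 3) ![4 * (μ : ℤ), 24 * μ, 24 * μ]) x y})
    {H LL MM δ A : ℤ} (hA : 4 * (μ : ℤ) < A) (hAH : A + 4 * μ ≤ H) (hA' : A ≤ 20 * (μ : ℤ))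
    (hLL : LL ≤ 24 * μ) (hMM : MM ≤ 24 * μ) (hδL : δ + 4 * μ + 1 < LL) :
    c ^ 3 ≤ (bondPercolation (zdGraph 3) p).real
      {ω | ¬ ∃ x ∈ Finset.Icc (0 : Site 3) ![H, LL, MM], ∃ y ∈ Finset.Icc (0 : Site 3) ![H, LL, MM],
        (x 0 = 0 ∨ (x 1 = LL ∧ x 0 < A)) ∧ (y 0 = H ∨ (y 1 = δ ∧ A ≤ y 0)) ∧
          ω ∈ openConnIn ↑(Finset.Icc (0 : Site 3) ![H, LL, MM]) x y} := by
  -- `D`: the wide box itself, in the seal spelling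
  have hD : c ≤ (bondPercolation (zdGraph 3) p).real
      (openCrossing (Set.Icc (0 : Site 3) ![4 * (μ : ℤ), 24 * μ, 24 * μ])
        {x | x ∈ Set.Icc (0 : Site 3) ![4 * (μ : ℤ), 24 * μ, 24 * μ] ∧ x 0 = (0 : Site 3) 0}
        {y | y ∈ Set.Icc (0 : Site 3) ![4 * (μ : ℤ), 24 * μ, 24 * μ] ∧
          y 0 = (![4 * (μ : ℤ), 24 * μ, 24 * μ] : Site 3) 0})ᶜ := by
    rw [← sealEvent_eq]; exact hW
  -- `U`: its translate by `A e₀`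
  have qU := StubTiling.real_seal_shift p (![A, 0, 0] : Site 3) 0 ![4 * (μ : ℤ), 24 * μ, 24 * μ] 0
  rw [zero_add, show (![4 * (μ : ℤ), 24 * μ, 24 * μ] : Site 3) + ![A, 0, 0] =
      ![A + 4 * μ, 24 * μ, 24 * μ] from funext fun l => by (fin_cases l <;> simp); ring] at qU
  have hU := hD.trans qU.symm.le
  -- `V`: its `(0 1)`-transpose translated by `(δ + 1) e₁`
  have qV := StubTiling.real_seal_perm_shift p (Equiv.swap 0 1) (![0, δ + 1, 0] : Site 3) 0
    ![4 * (μ : ℤ), 24 * μ, 24 * μ] 0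
  rw [Site.signedPerm_zero, zero_add,
    show Site.signedPerm (Equiv.swap (0 : Fin 3) 1) 1 (![4 * (μ : ℤ), 24 * μ, 24 * μ] : Site 3) +
        ![0, δ + 1, 0] = ![24 * (μ : ℤ), δ + 1 + 4 * μ, 24 * μ] from
      funext fun l => by (fin_cases l <;> simp [Equiv.swap_apply_of_ne_of_ne]); ring,
    show Equiv.swap (0 : Fin 3) 1 0 = 1 from Equiv.swap_apply_left 0 1] at qV
  have hV := hD.trans qV.symm.le
  -- Harris–FKG, then the staircase almost surely
  calc c ^ 3 = c * c * c := by ring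
    _ ≤ _ := mul_le_mul (mul_le_mul hD hU hc measureReal_nonneg) hV hc
        (mul_nonneg measureReal_nonneg measureReal_nonneg)
    _ ≤ _ := mul_le_mul_of_nonneg_right (harris_fkg_lower _ p (StubTiling.isLowerSet_seal _ _ _)
        (StubTiling.isLowerSet_seal _ _ _) (StubTiling.measurableSet_seal _ _ _)
        (StubTiling.measurableSet_seal _ _ _)) measureReal_nonneg
    _ ≤ _ := harris_fkg_lower _ p
        ((StubTiling.isLowerSet_seal _ _ _).inter (StubTiling.isLowerSet_seal _ _ _))
        (StubTiling.isLowerSet_seal _ _ _)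
        ((StubTiling.measurableSet_seal _ _ _).inter (StubTiling.measurableSet_seal _ _ _))
        (StubTiling.measurableSet_seal _ _ _)
    _ ≤ _ := DCT16.real_mono_of_forall_subset_edgeSet _ p fun ω hω h =>
        staircase (by simp) (by simp) (by simp; omega) (by simp) (by simpa using hLL) (by simp)
          (by simpa using hMM) (by simp) (by simp) (by simpa using hAH) (by simp) (by simpa using hLL)
          (by simp) (by simpa using hMM) (by simp) (by simp; omega) (by simp) (by simp) (by simp; omega)
          (by simp) (by simpa using hMM) hω h.1.1 h.1.2 h.2

/-! ### The finite floor for small shapes -/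

/-- **Positivity floor.** For every `p` and finite `R ⊆ Rbig`, if `Src` and `Tgt` are disjoint on
`R` then `P_p(no open path inside R from Src to Tgt) ≥ (1 - p)^{#Rbig.sym2}`: when every pair of
vertices of `Rbig` is closed (`le_bondPercolation_real_forall_notMem`) an open path inside `R` has no
first step, and the trivial path joins no `x ∈ Src ∩ Tgt`. [folklore] -/
theorem tilt_floor (p : unitInterval) {R Rbig : Finset (Site 3)} (hsub : R ⊆ Rbig)
    {Src Tgt : Site 3 → Prop} (hdisj : ∀ x ∈ R, Src x → Tgt x → False) :
    (1 - (p : ℝ)) ^ Rbig.sym2.card ≤ (bondPercolation (zdGraph 3) p).real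
      {ω | ¬ ∃ x ∈ R, ∃ y ∈ R, Src x ∧ Tgt y ∧ ω ∈ openConnIn ↑R x y} := by
  -- adapted from `RungOfTallTilt.real_blocked_pos`
  refine (le_bondPercolation_real_forall_notMem (zdGraph 3) p Rbig.sym2).trans
    (measureReal_mono fun ω hω => ?_)
  have hω' : ∀ e ∈ Rbig.sym2, e ∉ ω := hω
  rintro ⟨x, hx, y, hy, hS, hT, hxy⟩
  obtain ⟨-, hr⟩ := DCT16.pathIn_of_mem_openConnIn hxy
  rcases Relation.ReflTransGen.cases_head hr with rfl | ⟨z, ⟨hadj, hz⟩, -⟩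
  · exact hdisj x hx hS hT
  · exact hω' _ (Finset.mk_mem_sym2_iff.2 ⟨hsub hx, hsub (Finset.mem_coe.1 hz)⟩)
      ((openGraph_adj ω x z).1 hadj).1

end TallTiltOfWideSeeds

/-! ### The certificate -/

/-- **`stub_tallTiltOfWideSeeds`** (consistency certificate for the registered stub `stub_tallTilt` of
the line `registered` of crux stmt-CriticalPhenomena-1141; registered itself by `workitem stub-add`).
HYPOTHESIS: verbatim the conclusion of `Theses.PercTiltedBlockers.WideBoxFromTilt` — the flat wide boxes
`R(4m; 24m, 24m)` are blocked at `p_c(ℤ³)` with probability `≥ c > 0` for every `m ≥ 1`. CONCLUSION: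
verbatim the registered text of `stub_tallTilt` — for every `k ≥ 1` a monotone `g`, `g > 0` on `(0,∞)`,
with `g(β(4km; L, M)) ≤ P(Tilt(R(4km; L, M); m, a))` for some `a`, all `m ≥ 1`, `L, M ∈ [2m, 5m]`. Proof:
`g :≡ min(c³, (1 - p_c)^{#pairs of [0,116k] × [0,145]²})` (constant), level `a = 4⌊(m-2)/4⌋ + 1`; for
`m ≥ 30` the staircase of three seals at scale `μ = ⌊(m-2)/4⌋` (`TallTiltOfWideSeeds.tilt_ge`), for
`m ≤ 29` the positivity floor (`TallTiltOfWideSeeds.tilt_floor`, `criticalProb_zd_lt_one`). [folklore] -/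
theorem stub_tallTiltOfWideSeeds :
    (∃ c : ℝ, 0 < c ∧ ∀ m : ℕ, 1 ≤ m → c ≤ (bondPercolation (zdGraph 3) (criticalProbI 3)).real
      {ω | ¬ ∃ x ∈ Finset.Icc (0 : Site 3) ![4 * (m : ℤ), 24 * m, 24 * m],
        ∃ y ∈ Finset.Icc (0 : Site 3) ![4 * (m : ℤ), 24 * m, 24 * m], x 0 = 0 ∧ y 0 = 4 * m ∧
          ω ∈ openConnIn ↑(Finset.Icc (0 : Site 3) ![4 * (m : ℤ), 24 * m, 24 * m]) x y}) →
    ∀ k : ℕ, 1 ≤ k →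
      ∃ g : ℝ → ℝ, Monotone g ∧ (∀ s, 0 < s → 0 < g s) ∧
        ∀ m L M : ℕ, 1 ≤ m → 2 * m ≤ L → L ≤ 5 * m → 2 * m ≤ M → M ≤ 5 * m → ∃ a : ℕ,
          g ((bondPercolation (zdGraph 3) (criticalProbI 3)).real
              {ω | ¬ ∃ x ∈ Finset.Icc (0 : Site 3) ![((4 * k * m : ℕ) : ℤ), L, M],
                ∃ y ∈ Finset.Icc (0 : Site 3) ![((4 * k * m : ℕ) : ℤ), L, M],
                  x 0 = 0 ∧ y 0 = ((4 * k * m : ℕ) : ℤ) ∧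
                    ω ∈ openConnIn ↑(Finset.Icc (0 : Site 3) ![((4 * k * m : ℕ) : ℤ), L, M]) x y}) ≤
          (bondPercolation (zdGraph 3) (criticalProbI 3)).real
            {ω | ¬ ∃ x ∈ Finset.Icc (0 : Site 3) ![((4 * k * m : ℕ) : ℤ), L, M],
              ∃ y ∈ Finset.Icc (0 : Site 3) ![((4 * k * m : ℕ) : ℤ), L, M],
                (x 0 = 0 ∨ (x 1 = L ∧ x 0 < a)) ∧
                  (y 0 = ((4 * k * m : ℕ) : ℤ) ∨ (y 1 = m ∧ (a : ℤ) ≤ y 0)) ∧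
                  ω ∈ openConnIn ↑(Finset.Icc (0 : Site 3) ![((4 * k * m : ℕ) : ℤ), L, M]) x y} := by
  rintro ⟨c, hc, hW⟩ k hk
  have hp : ((criticalProbI 3 : unitInterval) : ℝ) < 1 := criticalProb_zd_lt_one (by norm_num)
  refine ⟨fun _ => min (c ^ 3) ((1 - ((criticalProbI 3 : unitInterval) : ℝ)) ^
      (Finset.Icc (0 : Site 3) ![((116 * k : ℕ) : ℤ), 145, 145]).sym2.card),
    fun _ _ _ => le_rfl, fun _ _ => lt_min (pow_pos hc 3) (pow_pos (by linarith) _),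
    fun m L M hm hL hL' hM hM' => ?_⟩
  -- linearise the height `4km =: N ≥ 4m`
  generalize hN : 4 * k * m = N
  have h4m : 4 * m ≤ N := by rw [← hN]; exact Nat.mul_le_mul_right m (by omega)
  -- the scale `μ = ⌊(m - 2)/4⌋` of the seal pieces; the tilt level is `a = 4μ + 1`
  obtain ⟨μ, hμ⟩ : ∃ μ : ℕ, μ = (m - 2) / 4 := ⟨_, rfl⟩
  have hμm : 4 * μ ≤ m := by omega
  refine ⟨4 * μ + 1, ?_⟩
  rcases Nat.lt_or_ge m 30 with hlt | hge
  · -- small scales (finitely many shapes for each `k`): the positivity floor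
    have hNk : N ≤ 116 * k := by
      rw [← hN]
      calc 4 * k * m ≤ 4 * k * 29 := Nat.mul_le_mul_left _ (by omega)
        _ = 116 * k := by ring
    refine (min_le_right _ _).trans (TallTiltOfWideSeeds.tilt_floor (criticalProbI 3)
      (Src := fun x : Site 3 => x 0 = 0 ∨ (x 1 = (L : ℤ) ∧ x 0 < ((4 * μ + 1 : ℕ) : ℤ)))
      (Tgt := fun y : Site 3 => y 0 = (N : ℤ) ∨ (y 1 = (m : ℤ) ∧ ((4 * μ + 1 : ℕ) : ℤ) ≤ y 0))
      (Finset.Icc_subset_Icc le_rfl fun l => ?_) fun x hx hS hT => ?_)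
    · fin_cases l <;> simp <;> omega
    · have hxR := TiltSquaring.mem_box0.1 hx
      push_cast at hS hT
      omega
  · -- large scales: the staircase of three seals at scale `μ ≥ 7`
    have hμ7 : 7 ≤ μ := by omega
    have hμ5 : m ≤ 4 * μ + 5 := by omega
    exact (min_le_left _ _).trans (TallTiltOfWideSeeds.tilt_ge (criticalProbI 3) hc.le (hW μ (by omega))
      (by push_cast; omega) (by push_cast; omega) (by push_cast; omega) (by omega) (by omega) (by omega))

/-- **The tall tilt comparison is not stronger than the route's two cruxes together**: 
`TiltComparison → CubeBlockingSeed → stub_tallTilt` (both hypotheses BY NAME, the route items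
stmt-CriticalPhenomena-6393 and stmt-CriticalPhenomena-1141; the landed `wideBoxFromTilt_proof` turns them
into the wide seeds consumed by `stub_tallTiltOfWideSeeds`). An honest-piece certificate only: as a route
to the crux it is circular. [folklore] -/
theorem tallTilt_of_tiltComparison_of_cubeBlockingSeed
    (hT : Summit.CriticalPhenomena.PercolationContinuityZ3.Theses.PercTiltedBlockers.TiltComparison)
    (hS : Summit.CriticalPhenomena.PercolationContinuityZ3.Theses.PercTiltedBlockers.CubeBlockingSeed) :
    ∀ k : ℕ, 1 ≤ k →
      ∃ g : ℝ → ℝ, Monotone g ∧ (∀ s, 0 < s → 0 < g s) ∧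
        ∀ m L M : ℕ, 1 ≤ m → 2 * m ≤ L → L ≤ 5 * m → 2 * m ≤ M → M ≤ 5 * m → ∃ a : ℕ,
          g ((bondPercolation (zdGraph 3) (criticalProbI 3)).real
              {ω | ¬ ∃ x ∈ Finset.Icc (0 : Site 3) ![((4 * k * m : ℕ) : ℤ), L, M],
                ∃ y ∈ Finset.Icc (0 : Site 3) ![((4 * k * m : ℕ) : ℤ), L, M],
                  x 0 = 0 ∧ y 0 = ((4 * k * m : ℕ) : ℤ) ∧
                    ω ∈ openConnIn ↑(Finset.Icc (0 : Site 3) ![((4 * k * m : ℕ) : ℤ), L, M]) x y}) ≤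
          (bondPercolation (zdGraph 3) (criticalProbI 3)).real
            {ω | ¬ ∃ x ∈ Finset.Icc (0 : Site 3) ![((4 * k * m : ℕ) : ℤ), L, M],
              ∃ y ∈ Finset.Icc (0 : Site 3) ![((4 * k * m : ℕ) : ℤ), L, M],
                (x 0 = 0 ∨ (x 1 = L ∧ x 0 < a)) ∧
                  (y 0 = ((4 * k * m : ℕ) : ℤ) ∨ (y 1 = m ∧ (a : ℤ) ≤ y 0)) ∧
                  ω ∈ openConnIn ↑(Finset.Icc (0 : Site 3) ![((4 * k * m : ℕ) : ℤ), L, M]) x y} :=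
  stub_tallTiltOfWideSeeds (wideBoxFromTilt_proof hT hS)

end Summit.CriticalPhenomena.PercolationContinuityZ3.Theorems.CubeBlockingSeed

end
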